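import Literature.Algebra.EuclideanLattices.SmoothingParameterProofs
import Literature.Algebra.EuclideanLattices.SuccessiveMinimaProofs
import Literature.Algebra.EuclideanLattices.SuccessiveMinimaPositivity
import Mathlib.Analysis.InnerProductSpace.Projection.FiniteDimensional
import Mathlib.Analysis.SpecificLimits.Basic
import HarnessLib

/-!
# MR07 Lemma 3.3 (`η_ε(L) ≤ √(ln(2n(1+1/ε))/π) · λₙ(L)`) — discharge, with Lemma 2.9 for discrete subgroups of any rank

Topic `Algebra/EuclideanLattices` (family `pqc`), sequel of `SmoothingParameterProofs.lean` /
`SmoothingParameterBounds.lean`. Everything here is PROVED; the file discharges the last named fact of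
`PQCDiscreteGaussian.lean`, `smoothingParameter_le_sqrt_log_mul_successiveMinimum` =
**Micciancio–Regev 2007, Lemma 3.3**: for a full-rank lattice `L` in dimension `n` and `ε > 0`,
`η_ε(L) ≤ √(ln(2n(1 + 1/ε))/π) · λₙ(L)`. The proof is the printed one (authors' version, pp. 11–12),
made fully rigorous on two points the text glosses over: (a) Lemma 2.9 (`ρ_{s,c}(Λ) ≤ ρ_s(Λ)`) is
needed for the rank-`(n-1)` sublattice `S_{i,0}` and a centre that need not lie in its span, so we
prove Lemma 2.9 for discrete subgroups of any rank and any centre; (b) primitivity of the `vᵢ`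
("without loss of generality") is not needed — an empty slice `S_{i,j}` has mass `0`, a nonempty one is
a translate of `S_{i,0}`.

## Results

* `tsum_gaussianFunction_sub_le_of_mem_span`, `tsum_gaussianFunction_sub_le_of_discrete`,
  `gaussianMass_le_gaussianMass_zero_of_discrete` — **MR07 Lemma 2.9 for a discrete subgroup `M` of any
  rank**: `ρ_{s,c}(M) ≤ ρ_s(M)` for all `s > 0`, `c ∈ E` (`M` is a full lattice of `span_ℝ M`, where the
  full-rank case `tsum_gaussianFunction_sub_le` of `GaussianLatticeSums.lean` applies; a general centre
  is first replaced by its orthogonal projection onto `span_ℝ M`, which decreases every `‖y - c‖`).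
* `orthSlice Λ v` — MR07's `S_{i,0} = {y ∈ Λ | ⟪y, v⟫ = 0}` as a `ℤ`-submodule (discrete when `Λ` is).
* `gaussianMass_slice_le` — one slice: `ρ_σ({y ∈ Λ | ⟪y, v⟫ = j}) ≤ e^{-π j²/(σ²‖v‖²)} ρ_σ(S₀)`
  (Pythagoras along `v`, translation to `S₀`, Lemma 2.9).
* `tsum_int_ite_exp_neg_mul_sq_le` — the scalar sum `∑_{j ≠ 0} e^{-a j²} ≤ 2/(eᵃ - 1)` (`a > 0`).
* `gaussianMass_sdiff_orthSlice_le` — all slices of one direction: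
  `ρ_σ(Λ ∖ S₀) ≤ 2/(e^{π/(σ²‖v‖²)} - 1) ρ_σ(S₀)` whenever `⟪Λ, v⟫ ⊆ ℤ`.
* `sdiff_zero_subset_iUnion_sdiff_orthSlice` — `Λ ∖ {0} ⊆ ⋃ᵢ (Λ ∖ S₀(vᵢ))` for `n` independent `vᵢ`.
* `toReal_gaussianMass_dual_sdiff_orthSlice_le` — solved form per direction,
  `ρ_σ(L* ∖ S₀(v)) ≤ 2/(X_v + 1) ρ_σ(L*)`, `X_v = e^{π/(σ²‖v‖²)}`, for `v ∈ L ∖ {0}`.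
* `toReal_gaussianMass_dual_sdiff_zero_le` — **the main estimate**: with `X₀ = e^{π/(σ²λₙ²)} > 2n - 1`,
  `ρ_σ(L* ∖ {0}) ≤ 2n/(X₀ + 1 - 2n)` (directions `vᵢ ∈ L`, `‖vᵢ‖ ≤ λₙ(L)`, from
  `exists_linearIndependent_norm_le_successiveMinimum_holds` and `successiveMinimum_mono_holds`).
* `gaussianMass_dual_sdiff_zero_le_at_sqrt_log` — at `s = √(ln(2n(1+1/ε))/π) λₙ`: `X₀ = 2n(1 + 1/ε)` and
  `ρ_{1/s}(L* ∖ {0}) ≤ 2n/(2n/ε + 1) ≤ ε`.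
* `smoothingParameter_le_sqrt_log_mul_successiveMinimum_holds` — the DISCHARGE (the zero space, where
  `η_ε = inf (0, ∞) = 0` and `λ₀ = 0`, is treated separately).

## References

* D. Micciancio, O. Regev, *Worst-case to average-case reductions based on Gaussian measures*,
  SIAM J. Comput. 37 (2007) 267–302; Lemma 2.9 (p. 9), Lemma 3.3 (pp. 11–12) of the authors' version
  (`lit read doi:10.1137/S0097539705447360`).
* W. Banaszczyk, *New bounds in some transference theorems in the geometry of numbers*, Math. Ann. 296
  (1993), Lemma 1.1 (the Poisson identity behind Lemma 2.9).
-/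

noncomputable section

open MeasureTheory Module Metric Filter
open scoped Real ENNReal InnerProductSpace Topology

namespace Literature.Algebra.EuclideanLattices

section Shift

variable {E : Type*} [NormedAddCommGroup E] [InnerProductSpace ℝ E] [FiniteDimensional ℝ E]

/-- **Micciancio–Regev 2007, Lemma 2.9, for a discrete subgroup of any rank, centre in the span**:
for a discrete `ℤ`-submodule `M` of a Euclidean space, `s > 0` and `c ∈ span_ℝ M`,
`ρ_{s,c}(M) ≤ ρ_s(M)`. (MR07 state Lemma 2.9 "for any lattice"; in the proof of Lemma 3.3 it is applied
to the rank-`(n-1)` lattice `S_{i,0}`. Proof: `M` is a full-rank lattice of the Euclidean space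
`span_ℝ M`, where the full-rank case `tsum_gaussianFunction_sub_le` applies.)
[cite: MicciancioRegev2007, Lemma 2.9] -/
theorem tsum_gaussianFunction_sub_le_of_mem_span (M : Submodule ℤ E) [DiscreteTopology M] {s : ℝ}
    (hs : 0 < s) {c : E} (hc : c ∈ Submodule.span ℝ (M : Set E)) :
    ∑' y : M, gaussianFunction s ((y : E) - c) ≤ ∑' y : M, gaussianFunction s (y : E) := by
  set W : Submodule ℝ E := Submodule.span ℝ (M : Set E) with hW
  borelize ↥W
  set f : W →ₗ[ℝ] E := W.subtype with hf
  set M₀ : Submodule ℤ W := M.comap (f.restrictScalars ℤ) with hM₀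
  have hsub : (M : Set E) ⊆ W := Submodule.subset_span
  have h_img : f '' M₀ = M := by
    rw [← LinearMap.coe_restrictScalars ℤ f, ← Submodule.map_coe (f.restrictScalars ℤ),
      Submodule.map_comap_eq_self]
    exact fun x hx ↦ LinearMap.mem_range.mpr ⟨⟨x, hsub hx⟩, rfl⟩
  haveI : DiscreteTopology M₀ := by
    refine DiscreteTopology.preimage_of_continuous_injective (M : Set E) ?_ (Submodule.injective_subtype _)
    exact LinearMap.continuous_of_finiteDimensional f
  haveI : IsZLattice ℝ M₀ := ⟨by
    rw [← (Submodule.map_injective_of_injective (Submodule.injective_subtype W)).eq_iff, Submodule.map_span,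
      Submodule.map_top, Submodule.range_subtype]
    change Submodule.span ℝ (f '' M₀) = W
    rw [h_img]⟩
  have key := tsum_gaussianFunction_sub_le M₀ hs (⟨c, hc⟩ : W)
  -- transfer along the bijection `M₀ ≃ M`
  let e : M₀ ≃ M :=
    { toFun := fun y ↦ ⟨((y : W) : E), y.2⟩
      invFun := fun y ↦ ⟨⟨(y : E), hsub y.2⟩, by
        change f ⟨(y : E), hsub y.2⟩ ∈ M
        simp [hf]⟩
      left_inv := fun y ↦ by ext; rfl
      right_inv := fun y ↦ by ext; rfl }
  have h1 : ∀ y : M₀, gaussianFunction s ((y : W) - ⟨c, hc⟩) = gaussianFunction s (((e y : M) : E) - c) :=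
    fun _ ↦ rfl
  have h2 : ∀ y : M₀, gaussianFunction s ((y : W) : W) = gaussianFunction s ((e y : M) : E) :=
    fun _ ↦ rfl
  simp_rw [h1, h2] at key
  rwa [e.tsum_eq (fun y : M ↦ gaussianFunction s ((y : E) - c)),
    e.tsum_eq (fun y : M ↦ gaussianFunction s (y : E))] at key

/-- **Micciancio–Regev 2007, Lemma 2.9, for a discrete subgroup of any rank and any centre**:
`ρ_{s,c}(M) = ∑_{y ∈ M} ρ_s(y - c) ≤ ∑_{y ∈ M} ρ_s(y) = ρ_s(M)` for every discrete `ℤ`-submodule `M` of a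
Euclidean space, `s > 0` and `c ∈ E` (reduce to `c ∈ span_ℝ M` by orthogonal projection: replacing `c`
by its projection `p` only decreases every `‖y - c‖² = ‖y - p‖² + ‖c - p‖²`).
[cite: MicciancioRegev2007, Lemma 2.9] -/
theorem tsum_gaussianFunction_sub_le_of_discrete (M : Submodule ℤ E) [DiscreteTopology M] {s : ℝ}
    (hs : 0 < s) (c : E) :
    ∑' y : M, gaussianFunction s ((y : E) - c) ≤ ∑' y : M, gaussianFunction s (y : E) := by
  set W : Submodule ℝ E := Submodule.span ℝ (M : Set E) with hW
  set p : E := W.starProjection c with hp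
  have hpW : p ∈ W := W.starProjection_apply_mem c
  refine le_trans ?_ (tsum_gaussianFunction_sub_le_of_mem_span M hs hpW)
  refine Summable.tsum_le_tsum (fun y ↦ ?_) (summable_gaussianFunction_sub M hs.ne' c)
    (summable_gaussianFunction_sub M hs.ne' p)
  have hy : (y : E) ∈ W := Submodule.subset_span y.2
  have horth : ⟪(y : E) - p, c - p⟫_ℝ = 0 := by
    have h1 : c - p ∈ Wᗮ := W.sub_starProjection_mem_orthogonal c
    have h2 : (y : E) - p ∈ W := W.sub_mem hy hpW
    exact (Submodule.mem_orthogonal W (c - p)).1 h1 _ h2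
  have hdecomp : (y : E) - c = ((y : E) - p) - (c - p) := by abel
  have hnorm : ‖(y : E) - c‖ ^ 2 = ‖(y : E) - p‖ ^ 2 + ‖c - p‖ ^ 2 := by
    rw [hdecomp, sq, sq, sq]
    exact norm_sub_sq_eq_norm_sq_add_norm_sq_real horth
  unfold gaussianFunction
  refine Real.exp_le_exp.2 ?_
  rw [hnorm, neg_mul, neg_mul, neg_div, neg_div, neg_le_neg_iff]
  refine div_le_div_of_nonneg_right ?_ (by positivity)
  nlinarith [Real.pi_pos, sq_nonneg ‖c - p‖]

/-- `ρ_{s,c}(M) ≤ ρ_s(M)` in the `ℝ≥0∞`-valued mass form, for a discrete subgroup `M` of any rank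
(Micciancio–Regev 2007, Lemma 2.9). [cite: MicciancioRegev2007, Lemma 2.9] -/
theorem gaussianMass_le_gaussianMass_zero_of_discrete (M : Submodule ℤ E) [DiscreteTopology M] {s : ℝ}
    (hs : 0 < s) (c : E) :
    gaussianMass s c (M : Set E) ≤ gaussianMass s 0 (M : Set E) := by
  rw [gaussianMass_coe_eq_ofReal_tsum M hs.ne' c, gaussianMass_coe_eq_ofReal_tsum M hs.ne' 0]
  refine ENNReal.ofReal_le_ofReal ?_
  simpa only [sub_zero] using tsum_gaussianFunction_sub_le_of_discrete M hs c

end Shift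

section Slices

variable {E : Type*} [NormedAddCommGroup E] [InnerProductSpace ℝ E] [FiniteDimensional ℝ E]

/-- MR07's `S_{i,0}` (proof of Lemma 3.3, p. 11): the vectors of `Λ` orthogonal to `v`, as a
`ℤ`-submodule `{y ∈ Λ | ⟪y, v⟫ = 0}`. [cite: MicciancioRegev2007, Lemma 3.3 (proof, p. 11)] -/
def orthSlice (Λ : Submodule ℤ E) (v : E) : Submodule ℤ E where
  carrier := {y | y ∈ Λ ∧ ⟪y, v⟫_ℝ = 0}
  add_mem' := fun {a b} ha hb ↦ ⟨Λ.add_mem ha.1 hb.1, by rw [inner_add_left, ha.2, hb.2, add_zero]⟩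
  zero_mem' := ⟨Λ.zero_mem, inner_zero_left _⟩
  smul_mem' := fun n y hy ↦ ⟨Λ.smul_mem n hy.1, by
    rw [← Int.cast_smul_eq_zsmul ℝ n y, real_inner_smul_left, hy.2, mul_zero]⟩

omit [FiniteDimensional ℝ E] in
/-- Membership in `orthSlice`. [cite: MicciancioRegev2007, Lemma 3.3 (proof, p. 11)] -/
theorem mem_orthSlice {Λ : Submodule ℤ E} {v y : E} : y ∈ orthSlice Λ v ↔ y ∈ Λ ∧ ⟪y, v⟫_ℝ = 0 :=
  Iff.rfl

omit [FiniteDimensional ℝ E] in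
/-- `S₀ ⊆ Λ`. [cite: MicciancioRegev2007, Lemma 3.3 (proof, p. 11)] -/
theorem orthSlice_le (Λ : Submodule ℤ E) (v : E) : orthSlice Λ v ≤ Λ := fun _ hy ↦ hy.1

/-- `S₀` is discrete when `Λ` is (a subgroup of a discrete subgroup).
[cite: MicciancioRegev2007, Lemma 3.3 (proof, p. 11)] -/
instance instDiscreteTopologyOrthSlice (Λ : Submodule ℤ E) [DiscreteTopology Λ] (v : E) :
    DiscreteTopology (orthSlice Λ v) :=
  DiscreteTopology.of_subset (s := (Λ : Set E)) ‹_› (orthSlice_le Λ v)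

/-- **One slice** (Micciancio–Regev 2007, proof of Lemma 3.3, p. 11:
"`ρ_{1/s}(S_{i,j}) = e^{-π‖j s uᵢ‖²} ρ_{1/s}(S_{i,j} - j uᵢ)`", "`S_{i,j} - j uᵢ = S_{i,0} - w`" and Lemma 2.9):
for a discrete subgroup `Λ`, `v ≠ 0`, `σ > 0` and `j ∈ ℤ`, the Gaussian mass of the slice
`S_j = {y ∈ Λ | ⟪y, v⟫ = j}` satisfies `ρ_σ(S_j) ≤ exp(-π j²/(σ²‖v‖²)) ρ_σ(S₀)` (here `uᵢ = v/‖v‖²`, so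
`‖j s uᵢ‖² = j²/(σ²‖v‖²)` with `σ = 1/s`; primitivity of `v` is not needed: an empty slice has mass `0`,
a nonempty one is a translate of `S₀`). [cite: MicciancioRegev2007, Lemma 3.3 (proof, p. 11)] -/
theorem gaussianMass_slice_le (Λ : Submodule ℤ E) [DiscreteTopology Λ] {v : E} (hv : v ≠ 0) {σ : ℝ}
    (hσ : 0 < σ) (j : ℤ) :
    gaussianMass σ 0 {y : E | y ∈ Λ ∧ ⟪y, v⟫_ℝ = j} ≤
      ENNReal.ofReal (Real.exp (-(π / (σ ^ 2 * ‖v‖ ^ 2) * (j : ℝ) ^ 2))) *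
        gaussianMass σ 0 (orthSlice Λ v : Set E) := by
  set A : Set E := {y : E | y ∈ Λ ∧ ⟪y, v⟫_ℝ = j} with hA
  rcases A.eq_empty_or_nonempty with hAe | ⟨y₀, hy₀⟩
  · rw [hAe, gaussianMass_empty]
    exact zero_le
  have hvn : 0 < ‖v‖ := norm_pos_iff.2 hv
  set t : E := ((j : ℝ) / ‖v‖ ^ 2) • v with ht
  -- (i) termwise: `ρ_σ(y) = e^{-a j²} ρ_σ(y - t)` on the slice
  have hterm : ∀ y ∈ A, gaussianFunction σ y =
      Real.exp (-(π / (σ ^ 2 * ‖v‖ ^ 2) * (j : ℝ) ^ 2)) * gaussianFunction σ (y - t) := by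
    intro y hy
    have hyv : ⟪y, v⟫_ℝ = j := hy.2
    have horth : ⟪y - t, t⟫_ℝ = 0 := by
      rw [ht, real_inner_smul_right, inner_sub_left, real_inner_smul_left, real_inner_self_eq_norm_sq, hyv]
      field_simp
      ring
    have hnt : ‖t‖ ^ 2 = (j : ℝ) ^ 2 / ‖v‖ ^ 2 := by
      rw [ht, norm_smul, mul_pow, Real.norm_eq_abs, sq_abs]
      field_simp
    have hpy : ‖y‖ ^ 2 = ‖y - t‖ ^ 2 + ‖t‖ ^ 2 := by
      have h := norm_add_sq_eq_norm_sq_add_norm_sq_real horth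
      rw [sub_add_cancel] at h
      nlinarith [h]
    rw [gaussianFunction, gaussianFunction, ← Real.exp_add, hpy, hnt]
    congr 1
    field_simp
    ring
  have hmass : gaussianMass σ 0 A = ENNReal.ofReal (Real.exp (-(π / (σ ^ 2 * ‖v‖ ^ 2) * (j : ℝ) ^ 2))) *
      gaussianMass σ t A := by
    rw [gaussianMass, gaussianMass, ← ENNReal.tsum_mul_left]
    refine tsum_congr fun y ↦ ?_
    rw [sub_zero, hterm y y.2, ENNReal.ofReal_mul (Real.exp_pos _).le]
  -- (ii) a nonempty slice is a translate of `S₀`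
  have hshift : gaussianMass σ t A = gaussianMass σ (t - y₀) (orthSlice Λ v : Set E) := by
    let e : (orthSlice Λ v : Set E) ≃ A :=
      { toFun := fun z ↦ ⟨(z : E) + y₀, ⟨Λ.add_mem z.2.1 hy₀.1, by rw [inner_add_left, z.2.2, hy₀.2, zero_add]⟩⟩
        invFun := fun y ↦ ⟨(y : E) - y₀, ⟨Λ.sub_mem y.2.1 hy₀.1, by rw [inner_sub_left, y.2.2, hy₀.2, sub_self]⟩⟩
        left_inv := fun z ↦ by ext; simp
        right_inv := fun y ↦ by ext; simp }
    rw [gaussianMass, gaussianMass, ← e.tsum_eq]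
    refine tsum_congr fun z ↦ ?_
    change ENNReal.ofReal (gaussianFunction σ ((z : E) + y₀ - t)) = ENNReal.ofReal (gaussianFunction σ ((z : E) - (t - y₀)))
    rw [sub_sub_eq_add_sub]
  rw [hmass, hshift]
  -- (iii) Lemma 2.9 for the lower-rank lattice `S₀`
  exact mul_le_mul_right (gaussianMass_le_gaussianMass_zero_of_discrete (orthSlice Λ v) hσ (t - y₀)) _

/-- The one-dimensional sum of the proof of Lemma 3.3 (Micciancio–Regev 2007, p. 11: "the bound
`∑_{j ≠ 0} x^{-j²} ≤ 2 ∑_{j > 0} x^{-j} = 2/(x - 1)` (valid for all `x > 1`)"), with `x = eᵃ`: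
`∑_{j ∈ ℤ, j ≠ 0} e^{-a j²} ≤ 2/(eᵃ - 1)` for `a > 0` (in `ℝ≥0∞`, the term `j = 0` replaced by `0`).
[cite: MicciancioRegev2007, Lemma 3.3 (proof, p. 11)] -/
theorem tsum_int_ite_exp_neg_mul_sq_le {a : ℝ} (ha : 0 < a) :
    (∑' j : ℤ, if j = 0 then (0 : ℝ≥0∞) else ENNReal.ofReal (Real.exp (-(a * (j : ℝ) ^ 2)))) ≤
      ENNReal.ofReal (2 / (Real.exp a - 1)) := by
  set c : ℤ → ℝ≥0∞ := fun j ↦ if j = 0 then 0 else ENNReal.ofReal (Real.exp (-(a * (j : ℝ) ^ 2))) with hc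
  set r : ℝ := Real.exp (-a) with hr
  have hr0 : 0 < r := Real.exp_pos _
  have hr1 : r < 1 := Real.exp_lt_one_iff.2 (neg_lt_zero.2 ha)
  -- the geometric tail in `ℝ≥0∞`
  have hgeom : ∑' n : ℕ, ENNReal.ofReal (r ^ (n + 1)) = ENNReal.ofReal (r / (1 - r)) := by
    have hs : Summable fun n : ℕ ↦ r ^ (n + 1) := by
      simp_rw [pow_succ']
      exact (summable_geometric_of_lt_one hr0.le hr1).mul_left r
    rw [← ENNReal.ofReal_tsum_of_nonneg (fun n ↦ by positivity) hs]
    congr 1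
    simp_rw [pow_succ']
    rw [tsum_mul_left, tsum_geometric_of_lt_one hr0.le hr1, div_eq_mul_inv]
  -- termwise: `e^{-a (n+1)²} ≤ e^{-a (n+1)} = r^{n+1}`
  have hbound : ∀ n : ℕ, ENNReal.ofReal (Real.exp (-(a * ((n : ℝ) + 1) ^ 2))) ≤ ENNReal.ofReal (r ^ (n + 1)) := by
    intro n
    refine ENNReal.ofReal_le_ofReal ?_
    rw [hr, ← Real.exp_nat_mul]
    refine Real.exp_le_exp.2 ?_
    push_cast
    have h1 : (0 : ℝ) ≤ n := n.cast_nonneg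
    nlinarith [mul_nonneg ha.le h1, mul_nonneg (mul_nonneg ha.le h1) h1]
  have hpos : ∑' n : ℕ, c (n : ℤ) ≤ ENNReal.ofReal (r / (1 - r)) := by
    rw [tsum_eq_zero_add' ENNReal.summable]
    have h0 : c ((0 : ℕ) : ℤ) = 0 := by simp [hc]
    rw [h0, zero_add, ← hgeom]
    refine ENNReal.tsum_le_tsum fun n ↦ ?_
    have hne : ((n + 1 : ℕ) : ℤ) ≠ 0 := by omega
    simp only [hc, hne, if_false]
    push_cast
    exact hbound n
  have hneg : ∑' n : ℕ, c (-((n : ℤ) + 1)) ≤ ENNReal.ofReal (r / (1 - r)) := by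
    rw [← hgeom]
    refine ENNReal.tsum_le_tsum fun n ↦ ?_
    have hne : (-((n : ℤ) + 1)) ≠ 0 := by omega
    simp only [hc, hne, if_false]
    push_cast
    rw [show (-((n : ℝ) + 1)) ^ 2 = ((n : ℝ) + 1) ^ 2 by ring]
    exact hbound n
  have hrr : 0 ≤ r / (1 - r) := div_nonneg hr0.le (sub_nonneg.2 hr1.le)
  have hkey : r / (1 - r) = 1 / (Real.exp a - 1) := by
    have hX : 1 < Real.exp a := Real.one_lt_exp_iff.2 ha
    have hrX : r * Real.exp a = 1 := by rw [hr, Real.exp_neg, inv_mul_cancel₀ (Real.exp_pos a).ne']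
    rw [div_eq_div_iff (sub_ne_zero.2 hr1.ne') (sub_ne_zero.2 hX.ne')]  -- hmm: 1 - r ≠ 0 ↔ 1 ≠ r
    nlinarith
  calc ∑' j : ℤ, c j = ∑' n : ℕ, c (n : ℤ) + ∑' n : ℕ, c (-((n : ℤ) + 1)) :=
        tsum_of_nat_of_neg_add_one ENNReal.summable ENNReal.summable
    _ ≤ ENNReal.ofReal (r / (1 - r)) + ENNReal.ofReal (r / (1 - r)) := add_le_add hpos hneg
    _ = ENNReal.ofReal (2 / (Real.exp a - 1)) := by
        rw [← ENNReal.ofReal_add hrr hrr, hkey]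
        congr 1
        ring

/-- **All nonzero slices in one direction** (Micciancio–Regev 2007, proof of Lemma 3.3, p. 11:
"`ρ_{1/s}(Λ* ∖ S_{i,0}) = ∑_{j ≠ 0} ρ_{1/s}(S_{i,j}) ≤ … ≤ 2/(e^{π(s/λₙ)²} - 1) · ρ_{1/s}(S_{i,0})`"), for a
single direction `v` with `⟪Λ, v⟫ ⊆ ℤ` and the exact exponent `π/(σ²‖v‖²)`:
`ρ_σ(Λ ∖ S₀) ≤ 2/(exp(π/(σ²‖v‖²)) - 1) · ρ_σ(S₀)`. [cite: MicciancioRegev2007, Lemma 3.3 (proof, p. 11)] -/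
theorem gaussianMass_sdiff_orthSlice_le (Λ : Submodule ℤ E) [DiscreteTopology Λ] {v : E} (hv : v ≠ 0)
    (hΛ : ∀ y ∈ Λ, ∃ j : ℤ, (j : ℝ) = ⟪y, v⟫_ℝ) {σ : ℝ} (hσ : 0 < σ) :
    gaussianMass σ 0 ((Λ : Set E) \ orthSlice Λ v) ≤
      ENNReal.ofReal (2 / (Real.exp (π / (σ ^ 2 * ‖v‖ ^ 2)) - 1)) * gaussianMass σ 0 (orthSlice Λ v : Set E) := by
  classical
  set a : ℝ := π / (σ ^ 2 * ‖v‖ ^ 2) with ha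
  have hvn : 0 < ‖v‖ := norm_pos_iff.2 hv
  have ha0 : 0 < a := by positivity
  set A : ℤ → Set E := fun j ↦ if j = 0 then ∅ else {y : E | y ∈ Λ ∧ ⟪y, v⟫_ℝ = j} with hA
  have hcover : (Λ : Set E) \ orthSlice Λ v ⊆ ⋃ j, A j := by
    rintro y ⟨hyΛ, hyS⟩
    obtain ⟨j, hj⟩ := hΛ y hyΛ
    have hj0 : j ≠ 0 := by
      rintro rfl
      exact hyS ⟨hyΛ, by rw [← hj, Int.cast_zero]⟩
    refine Set.mem_iUnion.2 ⟨j, ?_⟩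
    simp only [hA, hj0, if_false]
    exact ⟨hyΛ, hj.symm⟩
  set c : ℤ → ℝ≥0∞ := fun j ↦ if j = 0 then 0 else ENNReal.ofReal (Real.exp (-(a * (j : ℝ) ^ 2))) with hc
  have hAj : ∀ j, gaussianMass σ 0 (A j) ≤ c j * gaussianMass σ 0 (orthSlice Λ v : Set E) := by
    intro j
    by_cases hj : j = 0
    · simp only [hA, hc, hj, if_true, gaussianMass_empty, zero_mul, le_refl]
    · simp only [hA, hc, hj, if_false]
      have h := gaussianMass_slice_le Λ hv hσ j
      rw [← ha] at h
      exact h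
  calc gaussianMass σ 0 ((Λ : Set E) \ orthSlice Λ v)
      ≤ gaussianMass σ 0 (⋃ j, A j) := gaussianMass_mono _ _ hcover
    _ ≤ ∑' j, gaussianMass σ 0 (A j) :=
        ENNReal.tsum_iUnion_le_tsum (fun y : E ↦ ENNReal.ofReal (gaussianFunction σ (y - 0))) A
    _ ≤ ∑' j, c j * gaussianMass σ 0 (orthSlice Λ v : Set E) := ENNReal.tsum_le_tsum hAj
    _ = (∑' j, c j) * gaussianMass σ 0 (orthSlice Λ v : Set E) := ENNReal.tsum_mul_right
    _ ≤ _ := mul_le_mul_left (tsum_int_ite_exp_neg_mul_sq_le ha0) _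

end Slices

section MainEstimate

variable {E : Type*} [NormedAddCommGroup E] [InnerProductSpace ℝ E] [FiniteDimensional ℝ E]

omit [FiniteDimensional ℝ E] in
/-- **Covering** (Micciancio–Regev 2007, proof of Lemma 3.3, p. 11: "since `v₁, …, vₙ ∈ Λ` are linearly
independent, any nonzero vector in `Λ*` must have a nonzero inner product with at least one of them, and
hence `Λ* ∖ {0} = ⋃ᵢ (Λ* ∖ S_{i,0})`"): for `n = dim E` linearly independent `vᵢ` and any `Λ`,
`Λ ∖ {0} ⊆ ⋃ᵢ (Λ ∖ S₀(vᵢ))`. [cite: MicciancioRegev2007, Lemma 3.3 (proof, p. 11)] -/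
theorem sdiff_zero_subset_iUnion_sdiff_orthSlice [FiniteDimensional ℝ E] {n : ℕ} {v : Fin n → E}
    (hli : LinearIndependent ℝ v) (hn : n = finrank ℝ E) (Λ : Submodule ℤ E) :
    (Λ : Set E) \ {0} ⊆ ⋃ i, ((Λ : Set E) \ orthSlice Λ (v i)) := by
  rintro y ⟨hyΛ, hy0⟩
  by_contra h
  simp only [Set.mem_iUnion, not_exists] at h
  have horth : ∀ i, ⟪y, v i⟫_ℝ = 0 := fun i ↦ by
    by_contra hne
    exact h i ⟨hyΛ, fun hmem ↦ hne hmem.2⟩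
  have hspan : Submodule.span ℝ (Set.range v) = ⊤ :=
    hli.span_eq_top_of_card_eq_finrank' (by rw [Fintype.card_fin, hn])
  have hy_orth : ∀ z ∈ Submodule.span ℝ (Set.range v), ⟪y, z⟫_ℝ = 0 := by
    intro z hz
    refine Submodule.span_induction (fun w hw ↦ ?_) ?_ (fun a b _ _ ha hb ↦ ?_) (fun r w _ hw ↦ ?_) hz
    · obtain ⟨i, rfl⟩ := hw
      exact horth i
    · exact inner_zero_right _
    · rw [inner_add_right, ha, hb, add_zero]
    · rw [real_inner_smul_right, hw, mul_zero]
  have hyy : ⟪y, y⟫_ℝ = 0 := hy_orth y (hspan ▸ Submodule.mem_top)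
  exact hy0 (inner_self_eq_zero.1 hyy)

variable (L : Submodule ℤ E) [DiscreteTopology L] [IsZLattice ℝ L]

/-- **One direction, solved** (Micciancio–Regev 2007, proof of Lemma 3.3, pp. 11–12: "Solving for
`ρ_{1/s}(Λ* ∖ S_{i,0})`, we get `ρ_{1/s}(Λ* ∖ S_{i,0}) ≤ 2/(e^{π(s/λₙ)²} + 1) · ρ_{1/s}(Λ*)`"), here for one
primal vector `v ∈ L ∖ {0}` with the exact exponent: `ρ_σ(L* ∖ S₀(v)) ≤ 2/(exp(π/(σ²‖v‖²)) + 1) · ρ_σ(L*)`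
(finite masses, as reals). [cite: MicciancioRegev2007, Lemma 3.3 (proof, pp. 11–12)] -/
theorem toReal_gaussianMass_dual_sdiff_orthSlice_le {v : E} (hvL : v ∈ L) (hv : v ≠ 0) {σ : ℝ}
    (hσ : 0 < σ) :
    (gaussianMass σ 0 ((dualLattice L : Set E) \ orthSlice (dualLattice L) v)).toReal ≤
      2 / (Real.exp (π / (σ ^ 2 * ‖v‖ ^ 2)) + 1) * (gaussianMass σ 0 (dualLattice L : Set E)).toReal := by
  set Λ : Submodule ℤ E := dualLattice L with hΛ
  have hint : ∀ y ∈ Λ, ∃ j : ℤ, (j : ℝ) = ⟪y, v⟫_ℝ := fun y hy ↦ mem_dualLattice.1 hy v hvL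
  set X : ℝ := Real.exp (π / (σ ^ 2 * ‖v‖ ^ 2)) with hX
  have hvn : 0 < ‖v‖ := norm_pos_iff.2 hv
  have hX1 : 1 < X := Real.one_lt_exp_iff.2 (by positivity)
  set T : ℝ≥0∞ := gaussianMass σ 0 ((Λ : Set E) \ orthSlice Λ v) with hT
  set S : ℝ≥0∞ := gaussianMass σ 0 (orthSlice Λ v : Set E) with hS
  set F : ℝ≥0∞ := gaussianMass σ 0 (Λ : Set E) with hF
  have hsub : (orthSlice Λ v : Set E) ⊆ (Λ : Set E) := SetLike.coe_subset_coe.2 (orthSlice_le Λ v)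
  have hFtop : F ≠ ∞ := gaussianMass_lattice_ne_top Λ hσ.ne' 0
  have hTtop : T ≠ ∞ := ne_top_of_le_ne_top hFtop (gaussianMass_mono _ _ Set.sdiff_subset)
  have hStop : S ≠ ∞ := ne_top_of_le_ne_top hFtop (gaussianMass_mono _ _ hsub)
  -- `ρ(Λ*) = ρ(S₀) + ρ(Λ* ∖ S₀)`
  have hsplit : F = S + T := by
    have hU : (orthSlice Λ v : Set E) ∪ ((Λ : Set E) \ orthSlice Λ v) = (Λ : Set E) :=
      Set.union_sdiff_cancel hsub
    rw [hF, hS, hT, gaussianMass, gaussianMass, gaussianMass,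
      ← tsum_congr_set_coe (fun x : E ↦ ENNReal.ofReal (gaussianFunction σ (x - 0))) hU,
      ENNReal.summable.tsum_union_disjoint (f := fun x : E ↦ ENNReal.ofReal (gaussianFunction σ (x - 0)))
        Set.disjoint_sdiff_right ENNReal.summable]
  have hB : T ≤ ENNReal.ofReal (2 / (X - 1)) * S := gaussianMass_sdiff_orthSlice_le Λ hv hint hσ
  have hκ : 0 ≤ 2 / (X - 1) := div_nonneg zero_le_two (sub_nonneg.2 hX1.le)
  have hreal : T.toReal ≤ 2 / (X - 1) * S.toReal := by
    have := ENNReal.toReal_mono (ENNReal.mul_ne_top ENNReal.ofReal_ne_top hStop) hB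
    rwa [ENNReal.toReal_mul, ENNReal.toReal_ofReal hκ] at this
  have hsum : F.toReal = S.toReal + T.toReal := by rw [hsplit, ENNReal.toReal_add hStop hTtop]
  have hT0 : 0 ≤ T.toReal := ENNReal.toReal_nonneg
  have hX0 : 0 < X - 1 := sub_pos.2 hX1
  have hXp : 0 < X + 1 := by linarith
  have h3 : T.toReal * (X - 1) ≤ 2 * (F.toReal - T.toReal) := by
    calc T.toReal * (X - 1) ≤ 2 / (X - 1) * S.toReal * (X - 1) := mul_le_mul_of_nonneg_right hreal hX0.le
      _ = 2 * S.toReal := by field_simp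
      _ = 2 * (F.toReal - T.toReal) := by rw [hsum]; ring
  have h4 : T.toReal * (X + 1) ≤ 2 * F.toReal := by nlinarith
  calc T.toReal = T.toReal * (X + 1) / (X + 1) := by field_simp
    _ ≤ 2 * F.toReal / (X + 1) := div_le_div_of_nonneg_right h4 hXp.le
    _ = 2 / (X + 1) * F.toReal := by ring

/-- **Micciancio–Regev 2007, Lemma 3.3, main estimate** (pp. 11–12: summing the directions,
"`ρ_{1/s}(Λ* ∖ {0}) ≤ ∑ᵢ ρ_{1/s}(Λ* ∖ S_{i,0}) ≤ 2n/(e^{π(s/λₙ)²} + 1) · ρ_{1/s}(Λ*)`", then "using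
`ρ_{1/s}(Λ*) = 1 + ρ_{1/s}(Λ* ∖ {0})` and solving"): for a full-rank lattice `L` in dimension `n ≥ 1`,
`σ > 0` and `X₀ = exp(π/(σ² λₙ(L)²))` with `X₀ + 1 > 2n`,
`ρ_σ(L* ∖ {0}) ≤ 2n/(X₀ + 1 - 2n)`. [cite: MicciancioRegev2007, Lemma 3.3 (proof, pp. 11–12)] -/
theorem toReal_gaussianMass_dual_sdiff_zero_le [Nontrivial E] {σ : ℝ} (hσ : 0 < σ)
    (hX : 2 * (finrank ℝ E : ℝ) <
      Real.exp (π / (σ ^ 2 * successiveMinimum L (finrank ℝ E) ^ 2)) + 1) :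
    (gaussianMass σ 0 ((dualLattice L : Set E) \ {0})).toReal ≤
      2 * finrank ℝ E /
        (Real.exp (π / (σ ^ 2 * successiveMinimum L (finrank ℝ E) ^ 2)) + 1 - 2 * finrank ℝ E) := by
  set n : ℕ := finrank ℝ E with hn
  set Λ : Submodule ℤ E := dualLattice L with hΛ
  set lam : ℝ := successiveMinimum L n with hlam
  have hn1 : 1 ≤ n := Module.finrank_pos
  have hlam0 : 0 < lam := successiveMinimum_pos_holds L hn1 le_rfl
  set X₀ : ℝ := Real.exp (π / (σ ^ 2 * lam ^ 2)) with hX₀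
  -- `n` short linearly independent primal vectors
  obtain ⟨v, hli, hv⟩ := exists_linearIndependent_norm_le_successiveMinimum_holds L
  have hvL : ∀ i, v i ∈ L := fun i ↦ (hv i).1
  have htop : Submodule.span ℝ (L : Set E) = ⊤ := IsZLattice.span_top
  have hvn : ∀ i : Fin n, ‖v i‖ ≤ lam := fun i ↦ (hv i).2.trans (by
    refine successiveMinimum_mono_holds L (by omega) ?_
    rw [htop, finrank_top])
  have hv0 : ∀ i, v i ≠ 0 := fun i ↦ hli.ne_zero i
  set M : ℝ≥0∞ := gaussianMass σ 0 ((Λ : Set E) \ {0}) with hM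
  set F : ℝ≥0∞ := gaussianMass σ 0 (Λ : Set E) with hF
  have hFtop : F ≠ ∞ := gaussianMass_lattice_ne_top Λ hσ.ne' 0
  have hMtop : M ≠ ∞ := ne_top_of_le_ne_top hFtop (gaussianMass_mono _ _ Set.sdiff_subset)
  have hFM : F.toReal = 1 + M.toReal := by
    rw [hF, gaussianMass_eq_add_sdiff_zero Λ σ 0, gaussianFunction_zero, ENNReal.ofReal_one,
      ENNReal.toReal_add ENNReal.one_ne_top hMtop, ENNReal.toReal_one]
  have hF0 : 0 ≤ F.toReal := ENNReal.toReal_nonneg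
  have hX1 : 0 < X₀ + 1 := by positivity
  -- each direction contributes at most `2/(X₀ + 1) ρ(Λ*)`
  have hdir : ∀ i, (gaussianMass σ 0 ((Λ : Set E) \ orthSlice Λ (v i))).toReal ≤ 2 / (X₀ + 1) * F.toReal := by
    intro i
    refine (toReal_gaussianMass_dual_sdiff_orthSlice_le L (hvL i) (hv0 i) hσ).trans ?_
    have hvi : 0 < ‖v i‖ := norm_pos_iff.2 (hv0 i)
    have hXi : X₀ ≤ Real.exp (π / (σ ^ 2 * ‖v i‖ ^ 2)) := by
      refine Real.exp_le_exp.2 (div_le_div_of_nonneg_left Real.pi_pos.le (by positivity) ?_)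
      exact mul_le_mul_of_nonneg_left (pow_le_pow_left₀ (norm_nonneg _) (hvn i) 2) (sq_nonneg σ)
    refine mul_le_mul_of_nonneg_right ?_ hF0
    exact div_le_div_of_nonneg_left zero_le_two hX1 (by linarith)
  -- union bound over the directions
  have hcover := sdiff_zero_subset_iUnion_sdiff_orthSlice hli hn Λ
  have hMle : M ≤ ∑ i, gaussianMass σ 0 ((Λ : Set E) \ orthSlice Λ (v i)) :=
    (gaussianMass_mono _ _ hcover).trans
      (ENNReal.tsum_iUnion_le (fun y : E ↦ ENNReal.ofReal (gaussianFunction σ (y - 0))) _)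
  have hne : ∀ i ∈ (Finset.univ : Finset (Fin n)), gaussianMass σ 0 ((Λ : Set E) \ orthSlice Λ (v i)) ≠ ∞ :=
    fun i _ ↦ ne_top_of_le_ne_top hFtop (gaussianMass_mono _ _ Set.sdiff_subset)
  have hMreal : M.toReal ≤ ∑ i, (gaussianMass σ 0 ((Λ : Set E) \ orthSlice Λ (v i))).toReal := by
    rw [← ENNReal.toReal_sum hne]
    exact ENNReal.toReal_mono (ENNReal.sum_ne_top.2 hne) hMle
  have hM1 : M.toReal ≤ n * (2 / (X₀ + 1)) * (1 + M.toReal) := by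
    calc M.toReal ≤ ∑ i, (gaussianMass σ 0 ((Λ : Set E) \ orthSlice Λ (v i))).toReal := hMreal
      _ ≤ ∑ _i : Fin n, 2 / (X₀ + 1) * F.toReal := Finset.sum_le_sum fun i _ ↦ hdir i
      _ = n * (2 / (X₀ + 1)) * (1 + M.toReal) := by
          rw [Finset.sum_const, Finset.card_univ, Fintype.card_fin, nsmul_eq_mul, hFM]
          ring
  -- solve for `ρ(Λ* ∖ {0})`
  have hM0 : 0 ≤ M.toReal := ENNReal.toReal_nonneg
  have hden : 0 < X₀ + 1 - 2 * n := by linarith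
  have h5 : M.toReal * (X₀ + 1) ≤ 2 * n * (1 + M.toReal) := by
    calc M.toReal * (X₀ + 1) ≤ n * (2 / (X₀ + 1)) * (1 + M.toReal) * (X₀ + 1) :=
          mul_le_mul_of_nonneg_right hM1 hX1.le
      _ = 2 * n * (1 + M.toReal) := by field_simp
  rw [le_div_iff₀ hden]
  nlinarith

/-- **Micciancio–Regev 2007, Lemma 3.3, at the printed parameter** (p. 12: "`ρ_{1/s}(Λ* ∖ {0}) ≤
2n/(e^{π(s/λₙ)²} + 1 - 2n) < 2n/(e^{π(s/λₙ)²} - 2n) = ε` by our choice of `s`"): for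
`s = √(ln(2n(1 + 1/ε))/π) · λₙ(L)` (`n ≥ 1`, `ε > 0`), `ρ_{1/s}(L* ∖ {0}) ≤ ε`.
[cite: MicciancioRegev2007, Lemma 3.3 (proof, p. 12)] -/
theorem gaussianMass_dual_sdiff_zero_le_at_sqrt_log [Nontrivial E] {ε : ℝ} (hε : 0 < ε) :
    gaussianMass (1 / (Real.sqrt (Real.log (2 * finrank ℝ E * (1 + 1 / ε)) / π) *
        successiveMinimum L (finrank ℝ E))) 0 ((dualLattice L : Set E) \ {0}) ≤ ENNReal.ofReal ε := by
  set n : ℕ := finrank ℝ E with hn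
  set lam : ℝ := successiveMinimum L n with hlam
  have hn1 : 1 ≤ n := Module.finrank_pos
  have hn1' : (1 : ℝ) ≤ n := by exact_mod_cast hn1
  have hlam0 : 0 < lam := successiveMinimum_pos_holds L hn1 le_rfl
  set ℓ : ℝ := Real.log (2 * n * (1 + 1 / ε)) with hℓ
  have hε1 : 0 < 1 / ε := by positivity
  have harg : 1 < 2 * (n : ℝ) * (1 + 1 / ε) := by nlinarith
  have hℓ0 : 0 < ℓ := Real.log_pos harg
  set s : ℝ := Real.sqrt (ℓ / π) * lam with hs
  have hsq : Real.sqrt (ℓ / π) ^ 2 = ℓ / π := Real.sq_sqrt (div_pos hℓ0 Real.pi_pos).le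
  have hs0 : 0 < s := mul_pos (Real.sqrt_pos.2 (div_pos hℓ0 Real.pi_pos)) hlam0
  have hσ : 0 < 1 / s := one_div_pos.2 hs0
  -- the exponent at this parameter: `π/((1/s)² λₙ²) = π s²/λₙ² = ℓ`
  have hexp : Real.exp (π / ((1 / s) ^ 2 * lam ^ 2)) = 2 * n * (1 + 1 / ε) := by
    have h1 : π / ((1 / s) ^ 2 * lam ^ 2) = ℓ := by
      rw [hs, div_pow, one_pow, mul_pow, hsq]
      field_simp
    rw [h1, hℓ, Real.exp_log (by positivity)]
  have hX : 2 * (n : ℝ) < Real.exp (π / ((1 / s) ^ 2 * lam ^ 2)) + 1 := by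
    rw [hexp]
    nlinarith
  have hmain := toReal_gaussianMass_dual_sdiff_zero_le L hσ hX
  rw [hexp] at hmain
  have hbound : 2 * (n : ℝ) / (2 * n * (1 + 1 / ε) + 1 - 2 * n) ≤ ε := by
    rw [div_le_iff₀ (by nlinarith)]
    have : ε * (2 * n * (1 + 1 / ε) + 1 - 2 * n) = 2 * n + ε := by field_simp; ring
    rw [this]
    linarith
  have hMtop : gaussianMass (1 / s) 0 ((dualLattice L : Set E) \ {0}) ≠ ∞ :=
    ne_top_of_le_ne_top (gaussianMass_lattice_ne_top (dualLattice L) hσ.ne' 0)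
      (gaussianMass_mono _ _ Set.sdiff_subset)
  exact (ENNReal.le_ofReal_iff_toReal_le hMtop hε.le).2 (hmain.trans hbound)

/-- **Discharge of `smoothingParameter_le_sqrt_log_mul_successiveMinimum`** (`PQCDiscreteGaussian.lean`):
**Micciancio–Regev 2007, Lemma 3.3**, `η_ε(L) ≤ √(ln(2n(1 + 1/ε))/π) · λₙ(L)` for every full-rank lattice
`L` in dimension `n` and every `ε > 0`. For `n ≥ 1` the printed parameter `s` belongs to the defining set of
`η_ε(L)` (`gaussianMass_dual_sdiff_zero_le_at_sqrt_log`), so the infimum is at most `s`; in the zero space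
both sides vanish (`η_ε = inf (0, ∞) = 0`, `λ₀ = 0`). [cite: MicciancioRegev2007, Lemma 3.3] -/
theorem smoothingParameter_le_sqrt_log_mul_successiveMinimum_holds :
    smoothingParameter_le_sqrt_log_mul_successiveMinimum L := by
  intro ε hε
  rcases subsingleton_or_nontrivial E with hE | hE
  · have h0 : finrank ℝ E = 0 := Module.finrank_zero_of_subsingleton
    rw [h0, successiveMinimum_zero, mul_zero]
    have hS : {s : ℝ | 0 < s ∧ gaussianMass (1 / s) 0 ((dualLattice L : Set E) \ {0}) ≤ ENNReal.ofReal ε} =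
        Set.Ioi 0 := by
      ext s
      simp only [Set.mem_setOf_eq, Set.mem_Ioi, dualLattice_sdiff_zero_eq_empty, gaussianMass_empty, zero_le,
        and_true]
    rw [smoothingParameter, hS, csInf_Ioi]
  · have hn1 : 1 ≤ finrank ℝ E := Module.finrank_pos
    have hn1' : (1 : ℝ) ≤ finrank ℝ E := by exact_mod_cast hn1
    have hε1 : 0 < 1 / ε := by positivity
    have harg : 1 < 2 * (finrank ℝ E : ℝ) * (1 + 1 / ε) := by nlinarith
    have hs0 : 0 < Real.sqrt (Real.log (2 * finrank ℝ E * (1 + 1 / ε)) / π) *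
        successiveMinimum L (finrank ℝ E) :=
      mul_pos (Real.sqrt_pos.2 (div_pos (Real.log_pos harg) Real.pi_pos))
        (successiveMinimum_pos_holds L hn1 le_rfl)
    exact csInf_le (smoothingSet_bddBelow L _) ⟨hs0, gaussianMass_dual_sdiff_zero_le_at_sqrt_log L hε⟩

end MainEstimate

end Literature.Algebra.EuclideanLattices

end
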